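import Summits.ValiantsHypothesis.ValiantsHypothesis.Theorems.FeketeSOSFeketeSOSHardPaleyRIPCompletion
import Mathlib.Analysis.SpecialFunctions.Pow.Real

/-!
# Route FeketeSOS — crux `FeketeSOSHard` (stmt-ValiantsHypothesis-3996), line `paley-rip`,
# stub `stub_paleyFlatRIP`: the completion bound is ATTAINED on the full support

The landed completion bound (`stub_paleyCompletionBound`): `|Q_p(S,w)| ≤ √p Σ_{a∈S}|w_a|²` for all
`S ⊆ [0,p)`.  The engine `stub_paleyFlatRIP` asks for `p^{1/2−κ}` in place of `√p` on SPARSE supports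
`#S ≤ p^{1/2+δ₁}`.  This file shows, sorry-free and without Gauss sums, that the sparsity restriction is
NECESSARY: on the full support `S = [0,p)` the Paley–Hankel form attains `√p` exactly.

* `paleyRow_eigen` — for an odd prime `p`, the explicit real vector
  `u_a = χ_p(a) − χ_p(a+1) + √p([a=0] − [a=1])` satisfies `Σ_{b<p} χ_p(a+b) u_b = √p · u_a` for all
  `a < p` (it is `(P + √p)(e_0 − e_1)` where `P = (χ_p(a+b))` and `P² = pI − J` by the Jacobsthal sums
  of `…PaleyRIPCompletion.lean`; `e_0 − e_1 ⊥ 𝟙`);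
* `paleyForm_full_eq_sqrt` — hence `Q_p([0,p), u) = √p Σ_{a<p}|u_a|²` with `u ≠ 0`
  (`exists_paleyForm_full_eq_sqrt`): the completion bound is sharp;
* `not_flatRIP_full` — consequently, for every odd prime `p` and every `κ > 0` the engine's inequality
  `|Q_p(S,w)| ≤ p^{1/2−κ} Σ|w_a|²` FAILS at `S = [0,p)`: restricted flatness is a statement about sparse
  supports only (the exponent `1/2 + δ₁` cannot reach `1`).

Honest framing: a sharpness remark for the census of the OPEN engine; the crux `FeketeSOSHard`, the
engine and `stub_tameReduction` remain open; nothing here bears on `VP ≠ VNP`.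
-/

-- the line's namespace repeats a path segment by convention (same as the other paley-rip files)
set_option linter.dupNamespace false

namespace Summit.ValiantsHypothesis.ValiantsHypothesis.Theorems.FeketeSOSHardPaleyRIP

open Finset
open scoped BigOperators

noncomputable section

section Sharp

variable (p : ℕ) [Fact p.Prime]

/-- Sums over `[0,p)` are sums over `ℤ/p` (via `ZMod.val`). [folklore] -/
theorem sum_range_eq_sum_zmod (g : ℕ → ℂ) : ∑ n ∈ range p, g n = ∑ x : ZMod p, g x.val := by
  classical
  have himg : (univ : Finset (ZMod p)).image ZMod.val = range p := by
    ext n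
    simp only [mem_image, mem_univ, true_and, mem_range]
    constructor
    · rintro ⟨x, rfl⟩
      exact ZMod.val_lt x
    · intro hn
      exact ⟨(n : ZMod p), by rw [ZMod.val_natCast, Nat.mod_eq_of_lt hn]⟩
  rw [← himg, sum_image fun x _ y _ h => ZMod.val_injective p h]

/-- Jacobsthal correlations along `[0,p)`: `Σ_{b<p} χ(a+b) χ(b+c) = [a=c]·p − 1` for `a, c < p`, `p` odd.
[folklore] -/
theorem sum_range_chi_add_mul_chi_add (hp2 : p ≠ 2) (a c : ℕ) (ha : a < p) (hc : c < p) :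
    ∑ b ∈ range p, ((quadraticChar (ZMod p) ((a : ZMod p) + (b : ZMod p)) : ℤ) : ℂ) *
        ((quadraticChar (ZMod p) ((b : ZMod p) + (c : ZMod p)) : ℤ) : ℂ) =
      (if a = c then (p : ℂ) else 0) - 1 := by
  rw [sum_range_eq_sum_zmod p (fun b => ((quadraticChar (ZMod p) ((a : ZMod p) + (b : ZMod p)) : ℤ) : ℂ) *
        ((quadraticChar (ZMod p) ((b : ZMod p) + (c : ZMod p)) : ℤ) : ℂ))]
  simp only [ZMod.natCast_val, ZMod.cast_id', id_eq]
  have hS : ∀ x ∈ range p, x < p := fun x hx => mem_range.1 hx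
  have hj := jac_nat p (S := range p) hS (mem_range.2 ha) (mem_range.2 hc)
  have hre : ∑ x : ZMod p, ((quadraticChar (ZMod p) ((a : ZMod p) + x) : ℤ) : ℂ) *
      ((quadraticChar (ZMod p) (x + (c : ZMod p)) : ℤ) : ℂ) =
      ∑ x : ZMod p, ((quadraticChar (ZMod p) (x + (a : ZMod p)) : ℤ) : ℂ) *
      ((quadraticChar (ZMod p) (x + (c : ZMod p)) : ℤ) : ℂ) := by
    refine sum_congr rfl fun x _ => ?_
    rw [add_comm (a : ZMod p) x]
  rw [hre, hj, if_neg hp2]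
  split_ifs <;> ring

/-- Picking out one term: `Σ_{b<p} χ(a+b)·[b = c] = χ(a+c)` for `c < p`. [folklore] -/
theorem sum_range_chi_add_ite (a c : ℕ) (hc : c < p) :
    ∑ b ∈ range p, ((quadraticChar (ZMod p) ((a : ZMod p) + (b : ZMod p)) : ℤ) : ℂ) *
        (if b = c then (1 : ℂ) else 0) =
      ((quadraticChar (ZMod p) ((a : ZMod p) + (c : ZMod p)) : ℤ) : ℂ) := by
  simp_rw [mul_ite, mul_one, mul_zero]
  rw [sum_ite_eq' (range p) c]
  rw [if_pos (mem_range.2 hc)]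

/-- **The explicit `√p`-eigenvector.**  For an odd prime `p` put
`u_a = χ(a) − χ(a+1) + √p([a=0] − [a=1])`; then `Σ_{b<p} χ_p(a+b) u_b = √p · u_a` for every `a < p`
(`u = (P + √p)(e_0 − e_1)`, `P² = pI − J`, `(e_0 − e_1) ⊥ 𝟙`). [folklore] -/
theorem paleyRow_eigen (hp2 : p ≠ 2) (a : ℕ) (ha : a < p) :
    ∑ b ∈ range p, ((quadraticChar (ZMod p) ((a : ZMod p) + (b : ZMod p)) : ℤ) : ℂ) *
        (((quadraticChar (ZMod p) ((b : ZMod p) + ((0 : ℕ) : ZMod p)) : ℤ) : ℂ) -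
          ((quadraticChar (ZMod p) ((b : ZMod p) + ((1 : ℕ) : ZMod p)) : ℤ) : ℂ) +
          (Real.sqrt p : ℂ) * ((if b = 0 then (1 : ℂ) else 0) - (if b = 1 then (1 : ℂ) else 0))) =
      (Real.sqrt p : ℂ) *
        (((quadraticChar (ZMod p) ((a : ZMod p) + ((0 : ℕ) : ZMod p)) : ℤ) : ℂ) -
          ((quadraticChar (ZMod p) ((a : ZMod p) + ((1 : ℕ) : ZMod p)) : ℤ) : ℂ) +
          (Real.sqrt p : ℂ) * ((if a = 0 then (1 : ℂ) else 0) - (if a = 1 then (1 : ℂ) else 0))) := by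
  have hprime : p.Prime := Fact.out
  have h0 : (0 : ℕ) < p := hprime.pos
  have h1 : (1 : ℕ) < p := hprime.one_lt
  have e0 := sum_range_chi_add_mul_chi_add p hp2 a 0 ha h0
  have e1 := sum_range_chi_add_mul_chi_add p hp2 a 1 ha h1
  have f0 := sum_range_chi_add_ite p a 0 h0
  have f1 := sum_range_chi_add_ite p a 1 h1
  have hsq : (Real.sqrt p : ℂ) * (Real.sqrt p : ℂ) = (p : ℂ) := by
    rw [← Complex.ofReal_mul, Real.mul_self_sqrt (Nat.cast_nonneg p)]
    push_cast
    rfl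
  -- distribute the row sum over the four pieces of `u`
  have hdist : ∀ b : ℕ,
      ((quadraticChar (ZMod p) ((a : ZMod p) + (b : ZMod p)) : ℤ) : ℂ) *
        (((quadraticChar (ZMod p) ((b : ZMod p) + ((0 : ℕ) : ZMod p)) : ℤ) : ℂ) -
          ((quadraticChar (ZMod p) ((b : ZMod p) + ((1 : ℕ) : ZMod p)) : ℤ) : ℂ) +
          (Real.sqrt p : ℂ) * ((if b = 0 then (1 : ℂ) else 0) - (if b = 1 then (1 : ℂ) else 0))) =
      ((quadraticChar (ZMod p) ((a : ZMod p) + (b : ZMod p)) : ℤ) : ℂ) *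
          ((quadraticChar (ZMod p) ((b : ZMod p) + ((0 : ℕ) : ZMod p)) : ℤ) : ℂ) -
        ((quadraticChar (ZMod p) ((a : ZMod p) + (b : ZMod p)) : ℤ) : ℂ) *
          ((quadraticChar (ZMod p) ((b : ZMod p) + ((1 : ℕ) : ZMod p)) : ℤ) : ℂ) +
        (Real.sqrt p : ℂ) * (((quadraticChar (ZMod p) ((a : ZMod p) + (b : ZMod p)) : ℤ) : ℂ) *
          (if b = 0 then (1 : ℂ) else 0)) -
        (Real.sqrt p : ℂ) * (((quadraticChar (ZMod p) ((a : ZMod p) + (b : ZMod p)) : ℤ) : ℂ) *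
          (if b = 1 then (1 : ℂ) else 0)) := by
    intro b; ring
  simp_rw [hdist]
  rw [sum_sub_distrib, sum_add_distrib, sum_sub_distrib, ← mul_sum, ← mul_sum, e0, e1, f0, f1]
  push_cast
  split_ifs with ha0 ha1 ha1'
  · omega
  · linear_combination (-1 : ℂ) * hsq
  · linear_combination (1 : ℂ) * hsq
  · ring

/-- A complex number with zero imaginary part squares to its norm squared. [folklore] -/
theorem mul_self_eq_norm_sq_of_im_eq_zero {z : ℂ} (hz : z.im = 0) : z * z = ((‖z‖ ^ 2 : ℝ) : ℂ) := by
  have hre : z = (z.re : ℂ) := Complex.ext (by simp) (by simp [hz])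
  rw [hre, Complex.norm_real, Real.norm_eq_abs, sq_abs]
  push_cast
  ring

/-- **The completion bound is attained on the full support.**  For an odd prime `p` the vector `u` of
`paleyRow_eigen` is non-zero and `Q_p([0,p), u) = √p Σ_{a<p} |u_a|²`. [folklore] -/
theorem exists_paleyForm_full_eq_sqrt (hp2 : p ≠ 2) :
    ∃ w : ℕ → ℂ, 0 < ∑ a ∈ range p, ‖w a‖ ^ 2 ∧
      paleyForm p (range p) w = ((Real.sqrt p * ∑ a ∈ range p, ‖w a‖ ^ 2 : ℝ) : ℂ) := by
  have hprime : p.Prime := Fact.out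
  set u : ℕ → ℂ := fun b =>
    ((quadraticChar (ZMod p) ((b : ZMod p) + ((0 : ℕ) : ZMod p)) : ℤ) : ℂ) -
      ((quadraticChar (ZMod p) ((b : ZMod p) + ((1 : ℕ) : ZMod p)) : ℤ) : ℂ) +
      (Real.sqrt p : ℂ) * ((if b = 0 then (1 : ℂ) else 0) - (if b = 1 then (1 : ℂ) else 0)) with hu
  refine ⟨u, ?_, ?_⟩
  · -- `u 0 = √p − 1 ≠ 0`
    have h0mem : 0 ∈ range p := mem_range.2 hprime.pos
    have hu0 : u 0 = ((Real.sqrt p - 1 : ℝ) : ℂ) := by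
      have h01 : ((quadraticChar (ZMod p) (((0 : ℕ) : ZMod p) + ((1 : ℕ) : ZMod p)) : ℤ) : ℂ) = 1 := by
        rw [Nat.cast_zero, Nat.cast_one, zero_add, map_one, Int.cast_one]
      have h00 : ((quadraticChar (ZMod p) (((0 : ℕ) : ZMod p) + ((0 : ℕ) : ZMod p)) : ℤ) : ℂ) = 0 := by
        rw [Nat.cast_zero, zero_add, quadraticChar_zero, Int.cast_zero]
      show ((quadraticChar (ZMod p) (((0 : ℕ) : ZMod p) + ((0 : ℕ) : ZMod p)) : ℤ) : ℂ) -
          ((quadraticChar (ZMod p) (((0 : ℕ) : ZMod p) + ((1 : ℕ) : ZMod p)) : ℤ) : ℂ) +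
          (Real.sqrt p : ℂ) * ((if (0 : ℕ) = 0 then (1 : ℂ) else 0) - (if (0 : ℕ) = 1 then (1 : ℂ) else 0)) =
        ((Real.sqrt p - 1 : ℝ) : ℂ)
      rw [h01, h00, if_pos rfl, if_neg (by decide)]
      push_cast
      ring
    have hsqrt : 1 < Real.sqrt p := by
      rw [show (1 : ℝ) = Real.sqrt 1 from Real.sqrt_one.symm]
      exact Real.sqrt_lt_sqrt (by norm_num) (by exact_mod_cast hprime.one_lt)
    have hpos : 0 < ‖u 0‖ ^ 2 := by
      rw [hu0, Complex.norm_real, Real.norm_eq_abs, sq_abs]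
      nlinarith
    exact lt_of_lt_of_le hpos (single_le_sum (f := fun a => ‖u a‖ ^ 2) (fun a _ => sq_nonneg _) h0mem)
  · rw [paleyForm_eq_sum_mul_uForm]
    have hrow : ∀ a ∈ range p,
        u a * ∑ b ∈ range p, ((quadraticChar (ZMod p) ((a : ZMod p) + (b : ZMod p)) : ℤ) : ℂ) * u b =
          (Real.sqrt p : ℂ) * ((‖u a‖ ^ 2 : ℝ) : ℂ) := by
      intro a ha
      have he := paleyRow_eigen p hp2 a (mem_range.1 ha)
      have him : (u a).im = 0 := by
        rw [hu]
        simp only [Complex.add_im, Complex.sub_im, Complex.mul_im, Complex.intCast_im,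
          Complex.ofReal_im, Complex.ofReal_re, zero_mul, add_zero]
        split_ifs <;> simp
      rw [show (∑ b ∈ range p, ((quadraticChar (ZMod p) ((a : ZMod p) + (b : ZMod p)) : ℤ) : ℂ) *
          u b) = (Real.sqrt p : ℂ) * u a from he]
      rw [← mul_self_eq_norm_sq_of_im_eq_zero him]
      ring
    rw [sum_congr rfl hrow, ← mul_sum]
    push_cast
    rfl

/-- **The engine fails on the full support.**  For every odd prime `p` and every `κ > 0` there is a
`w` with `|Q_p([0,p), w)| > p^{1/2−κ} Σ_{a<p}|w_a|²`: the size restriction `#S ≤ p^{1/2+δ₁}` in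
`stub_paleyFlatRIP` is necessary (flatness is a property of SPARSE principal blocks only). [folklore] -/
theorem not_flatRIP_full (hp2 : p ≠ 2) (κ : ℝ) (hκ : 0 < κ) :
    ¬ ∀ w : ℕ → ℂ, ‖paleyForm p (range p) w‖ ≤ (p : ℝ) ^ (1 / 2 - κ) * ∑ a ∈ range p, ‖w a‖ ^ 2 := by
  intro h
  have hprime : p.Prime := Fact.out
  obtain ⟨w, hwpos, hQ⟩ := exists_paleyForm_full_eq_sqrt p hp2
  have hw := h w
  rw [hQ, Complex.norm_real, Real.norm_eq_abs,
    abs_of_nonneg (mul_nonneg (Real.sqrt_nonneg _) hwpos.le)] at hw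
  have hlt : (p : ℝ) ^ (1 / 2 - κ) < Real.sqrt p := by
    rw [Real.sqrt_eq_rpow]
    exact Real.rpow_lt_rpow_of_exponent_lt (by exact_mod_cast hprime.one_lt) (by linarith)
  have := mul_lt_mul_of_pos_right hlt hwpos
  linarith

/-- **Flatness forces sparsity, quantitatively.**  If at an odd prime `p` the engine's inequality holds
with exponents `(κ, δ₁)`, `κ > 0` — i.e. `|Q_p(S,w)| ≤ p^{1/2−κ} Σ|w_a|²` for all `S ⊆ [0,p)` with
`#S ≤ p^{1/2+δ₁}` — then `p^{1/2+δ₁} < p`: the full support is never admissible (by `not_flatRIP_full`).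
[folklore] -/
theorem rpow_lt_self_of_flatRIPAt (hp2 : p ≠ 2) (κ δ₁ : ℝ) (hκ : 0 < κ)
    (hB : ∀ (S : Finset ℕ), (∀ a ∈ S, a < p) → (S.card : ℝ) ≤ (p : ℝ) ^ (1 / 2 + δ₁) →
      ∀ (w : ℕ → ℂ), ‖paleyForm p S w‖ ≤ (p : ℝ) ^ (1 / 2 - κ) * ∑ a ∈ S, ‖w a‖ ^ 2) :
    (p : ℝ) ^ (1 / 2 + δ₁) < p := by
  by_contra hle
  push Not at hle
  refine not_flatRIP_full p hp2 κ hκ (hB (range p) (fun a ha => mem_range.1 ha) ?_)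
  rw [card_range]
  exact hle

/-- **Corollary: `δ₁ < 1/2` for any valid exponent pair of the engine.**  If the inequality of
`stub_paleyFlatRIP` holds with exponents `(κ, δ₁)`, `κ > 0`, at some odd prime `p`, then `δ₁ < 1/2`.
[folklore] -/
theorem delta_lt_half_of_flatRIPAt (hp2 : p ≠ 2) (κ δ₁ : ℝ) (hκ : 0 < κ)
    (hB : ∀ (S : Finset ℕ), (∀ a ∈ S, a < p) → (S.card : ℝ) ≤ (p : ℝ) ^ (1 / 2 + δ₁) →
      ∀ (w : ℕ → ℂ), ‖paleyForm p S w‖ ≤ (p : ℝ) ^ (1 / 2 - κ) * ∑ a ∈ S, ‖w a‖ ^ 2) :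
    δ₁ < 1 / 2 := by
  have hprime : p.Prime := Fact.out
  have hp1 : (1 : ℝ) < (p : ℝ) := by exact_mod_cast hprime.one_lt
  have h := rpow_lt_self_of_flatRIPAt p hp2 κ δ₁ hκ hB
  have h' : (p : ℝ) ^ (1 / 2 + δ₁) < (p : ℝ) ^ (1 : ℝ) := by rwa [Real.rpow_one]
  have := (Real.rpow_lt_rpow_left_iff hp1).1 h'
  linarith

end Sharp

end

end Summit.ValiantsHypothesis.ValiantsHypothesis.Theorems.FeketeSOSHardPaleyRIP
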